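import Summits.Ventures.Crystal3D.Bulk.GapOrientedDarts
import Mathlib.Dynamics.PeriodicPts.Defs
import HarnessLib

/-!
# ORIENTED faces of the two-level tight map: orbits of the oriented face successor, face
# lengths, the partition of the darts into faces, Euler's formula as an angle identity
# (`phase2/LEAN-FACES-DESIGN.md` (F1), on top of `Bulk/GapOrientation.lean`)

HONEST FRAMING. Part of the venture `Summits/Ventures/Crystal3D` (cell `pub-crystal3d`, phase 2;
seat typer-bulk-2). This is the oriented twin of `Bulk/GapFaces.lean`: there the orbits of the
azimuth face successor `faceSucc` were organised into "faces", but the azimuth frames have an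
unspecified handedness at each vertex (erratum in `Bulk/GapOrientation.lean`), so THOSE orbits
are the faces of the drawing only up to per-vertex handedness. Here the same theory is built on
the consistently oriented successor `ofaceSucc c` of `Bulk/GapOrientedDarts.lean` (counter-clockwise
seen from outside at EVERY vertex), whose orbits ARE the faces of the drawn tight map:

* closed walks: `IsGapConfig.iterate_ofaceSucc_mem_darts`, `iterate_ofaceSucc_injOn`,
  `exists_iterate_ofaceSucc_eq_self` (every dart returns);
* `ofaceOf c q` — the oriented face through the dart `q` (the `φ°`-orbit as a `Finset` of darts),
  `ofaceLen c q` (Mathlib's `Function.minimalPeriod`), `card_ofaceOf`, `mem_ofaceOf_iff`,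
  `ofaceOf_iterate` / `ofaceOf_eq_of_mem`, `IsGapConfig.ofaceOf_subset_darts`;
* `ofaces c`, `onumFaces c`; **the oriented faces partition the darts**
  (`IsGapConfig.pairwiseDisjoint_ofaces`, `IsGapConfig.biUnion_ofaces`,
  `IsGapConfig.sum_card_ofaces : Σ_{F ∈ ofaces c} #F = 2 · tightCount c`);
* **every oriented face has `≥ 3` darts** under the census socket
  (`CensusRows.three_le_ofaceLen`, `CensusRows.three_mul_onumFaces_le`);
* `ofaceAngleSum c F = Σ_{q ∈ F} ofaceCorner c q`, `IsGapConfig.sum_ofaceAngleSum`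
  (`= 2π · #activeVertices`), and **Euler's formula as an angle identity**
  `IsGapConfig.oriented_euler_angle_identity`:
  `Σ_{F ∈ ofaces c} (ofaceAngleSum c F − (#F − 2)·π) = 2π · (#activeVertices − tightCount + onumFaces)`,
  `IsGapConfig.oriented_euler_iff_excess` (`V′ − E + F = 2 ⟺` total angular excess `= 4π`).

Nothing is claimed about GAP(1.26): planarity `V′ − E + F = 2` itself (F2), faces as REGIONS of
the sphere, Lemma L and the face-size bounds are NOT here.
-/

noncomputable section

open scoped BigOperators
open Finset Function

namespace Summit.Ventures.Crystal3D

variable {c : Fin 14 → EuclideanSpace ℝ (Fin 3)}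

/-! ## Oriented face walks close up -/

/-- Iterates of the oriented face successor stay in the darts. -/
theorem IsGapConfig.iterate_ofaceSucc_mem_darts (hc : IsGapConfig c) (hD3 : intruderDist c ^ 2 < 3)
    {q : Fin 14 × Fin 14} (hq : q ∈ darts c) (n : ℕ) : (ofaceSucc c)^[n] q ∈ darts c := by
  induction n with
  | zero => exact hq
  | succ n ih =>
    rw [Function.iterate_succ_apply']
    exact hc.ofaceSucc_mem_darts hD3 ih

/-- Iterates of the oriented face successor are injective in the starting dart. -/
theorem IsGapConfig.iterate_ofaceSucc_injOn (hc : IsGapConfig c) (hD3 : intruderDist c ^ 2 < 3)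
    (n : ℕ) : Set.InjOn ((ofaceSucc c)^[n]) (darts c : Set (Fin 14 × Fin 14)) := by
  induction n with
  | zero => intro x _ y _ h; exact h
  | succ n ih =>
    intro x hx y hy h
    rw [Function.iterate_succ_apply', Function.iterate_succ_apply'] at h
    have hx' := hc.iterate_ofaceSucc_mem_darts hD3 (Finset.mem_coe.1 hx) n
    have hy' := hc.iterate_ofaceSucc_mem_darts hD3 (Finset.mem_coe.1 hy) n
    exact ih hx hy (hc.ofaceSucc_injOn hD3 (Finset.mem_coe.2 hx') (Finset.mem_coe.2 hy') h)

/-- **Every dart returns to itself under the oriented face successor** (pigeonhole +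
cancellation): some `0 < n ≤ #darts` has `φ°^[n] q = q`. -/
theorem IsGapConfig.exists_iterate_ofaceSucc_eq_self (hc : IsGapConfig c)
    (hD3 : intruderDist c ^ 2 < 3) {q : Fin 14 × Fin 14} (hq : q ∈ darts c) :
    ∃ n : ℕ, 0 < n ∧ n ≤ (darts c).card ∧ (ofaceSucc c)^[n] q = q := by
  classical
  have hmaps : ∀ k ∈ Finset.range ((darts c).card + 1), (ofaceSucc c)^[k] q ∈ darts c :=
    fun k _ => hc.iterate_ofaceSucc_mem_darts hD3 hq k
  have hlt : (darts c).card < (Finset.range ((darts c).card + 1)).card := by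
    rw [Finset.card_range]; exact Nat.lt_succ_self _
  obtain ⟨a, ha, b, hb, hab, heq⟩ :=
    Finset.exists_ne_map_eq_of_card_lt_of_maps_to hlt hmaps
  rw [Finset.mem_range] at ha hb
  wlog hlt' : a < b generalizing a b
  · exact this b hb a ha hab.symm heq.symm (lt_of_le_of_ne (not_lt.1 hlt') (Ne.symm hab))
  refine ⟨b - a, Nat.sub_pos_of_lt hlt', by omega, ?_⟩
  have h1 : (ofaceSucc c)^[a] ((ofaceSucc c)^[b - a] q) = (ofaceSucc c)^[a] q := by
    rw [← Function.iterate_add_apply, Nat.add_sub_cancel' hlt'.le]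
    exact heq.symm
  exact hc.iterate_ofaceSucc_injOn hD3 a
    (Finset.mem_coe.2 (hc.iterate_ofaceSucc_mem_darts hD3 hq (b - a))) (Finset.mem_coe.2 hq) h1

/-! ## The face through a dart -/

/-- Every dart is a periodic point of the face successor (admissible, `D² < 3`). -/
theorem IsGapConfig.mem_periodicPts_ofaceSucc (hc : IsGapConfig c) (hD3 : intruderDist c ^ 2 < 3)
    {q : Fin 14 × Fin 14} (hq : q ∈ darts c) : q ∈ periodicPts (ofaceSucc c) := by
  obtain ⟨n, hn0, -, hn⟩ := hc.exists_iterate_ofaceSucc_eq_self hD3 hq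
  exact mk_mem_periodicPts hn0 hn

/-- **The length of the face through the dart `q`**: the least `n > 0` with `φ^[n] q = q`
(Mathlib's `Function.minimalPeriod`; `0` if the walk does not close, which does not happen for
darts of admissible configurations). -/
def ofaceLen (c : Fin 14 → EuclideanSpace ℝ (Fin 3)) (q : Fin 14 × Fin 14) : ℕ :=
  minimalPeriod (ofaceSucc c) q

/-- **The face through the dart `q`**: its orbit `{q, φ q, …, φ^[ofaceLen − 1] q}` under the face
successor, as a finset of darts (the combinatorial face to the left of `q`). -/
def ofaceOf (c : Fin 14 → EuclideanSpace ℝ (Fin 3)) (q : Fin 14 × Fin 14) :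
    Finset (Fin 14 × Fin 14) :=
  (Finset.range (ofaceLen c q)).image fun n => (ofaceSucc c)^[n] q

/-- The walk closes after `ofaceLen` steps. -/
theorem iterate_ofaceLen (c : Fin 14 → EuclideanSpace ℝ (Fin 3)) (q : Fin 14 × Fin 14) :
    (ofaceSucc c)^[ofaceLen c q] q = q :=
  iterate_minimalPeriod

/-- The face length of a dart is positive (admissible, `D² < 3`). -/
theorem IsGapConfig.ofaceLen_pos (hc : IsGapConfig c) (hD3 : intruderDist c ^ 2 < 3)
    {q : Fin 14 × Fin 14} (hq : q ∈ darts c) : 0 < ofaceLen c q :=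
  minimalPeriod_pos_of_mem_periodicPts (hc.mem_periodicPts_ofaceSucc hD3 hq)

/-- **A face has `ofaceLen` darts** (the iterates below the minimal period are distinct). -/
theorem card_ofaceOf (c : Fin 14 → EuclideanSpace ℝ (Fin 3)) (q : Fin 14 × Fin 14) :
    (ofaceOf c q).card = ofaceLen c q := by
  unfold ofaceOf
  rw [Finset.card_image_of_injOn, Finset.card_range]
  intro m hm n hn hmn
  rw [Finset.coe_range, Set.mem_Iio] at hm hn
  exact iterate_injOn_Iio_minimalPeriod hm hn hmn

/-- Membership in a face: `q' ∈ ofaceOf c q ↔ q' = φ^[n] q` for some `n` (`q` periodic). -/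
theorem mem_ofaceOf_iff {q q' : Fin 14 × Fin 14} (hq : q ∈ periodicPts (ofaceSucc c)) :
    q' ∈ ofaceOf c q ↔ ∃ n, (ofaceSucc c)^[n] q = q' := by
  unfold ofaceOf ofaceLen
  rw [Finset.mem_image]
  constructor
  · rintro ⟨n, -, hn⟩
    exact ⟨n, hn⟩
  · rintro ⟨n, rfl⟩
    refine ⟨n % minimalPeriod (ofaceSucc c) q, ?_, iterate_mod_minimalPeriod_eq⟩
    rw [Finset.mem_range]
    exact Nat.mod_lt _ (minimalPeriod_pos_of_mem_periodicPts hq)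

/-- A dart lies on its own face. -/
theorem self_mem_ofaceOf {q : Fin 14 × Fin 14} (hq : q ∈ periodicPts (ofaceSucc c)) :
    q ∈ ofaceOf c q :=
  (mem_ofaceOf_iff hq).2 ⟨0, rfl⟩

/-- Iterates lie on the face. -/
theorem iterate_mem_ofaceOf {q : Fin 14 × Fin 14} (hq : q ∈ periodicPts (ofaceSucc c)) (n : ℕ) :
    (ofaceSucc c)^[n] q ∈ ofaceOf c q :=
  (mem_ofaceOf_iff hq).2 ⟨n, rfl⟩

/-- A face is closed under the face successor. -/
theorem ofaceSucc_mem_ofaceOf {q q' : Fin 14 × Fin 14} (hq : q ∈ periodicPts (ofaceSucc c))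
    (hq' : q' ∈ ofaceOf c q) : ofaceSucc c q' ∈ ofaceOf c q := by
  obtain ⟨n, rfl⟩ := (mem_ofaceOf_iff hq).1 hq'
  have he : ofaceSucc c ((ofaceSucc c)^[n] q) = (ofaceSucc c)^[n + 1] q :=
    (Function.iterate_succ_apply' (ofaceSucc c) n q).symm
  rw [he]
  exact iterate_mem_ofaceOf hq (n + 1)

/-- **The face through an iterate is the same face.** -/
theorem ofaceOf_iterate {q : Fin 14 × Fin 14} (hq : q ∈ periodicPts (ofaceSucc c)) (n : ℕ) :
    ofaceOf c ((ofaceSucc c)^[n] q) = ofaceOf c q := by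
  have hq' : (ofaceSucc c)^[n] q ∈ periodicPts (ofaceSucc c) := by
    obtain ⟨p, hp, hper⟩ := hq
    exact ⟨p, hp, hper.apply_iterate n⟩
  ext x
  rw [mem_ofaceOf_iff hq', mem_ofaceOf_iff hq]
  constructor
  · rintro ⟨m, rfl⟩
    exact ⟨m + n, by rw [Function.iterate_add_apply]⟩
  · rintro ⟨m, rfl⟩
    -- go around: `φ^[m] q = φ^[m + (p - n % p)] (φ^[n] q)` with `p` the period
    set p := minimalPeriod (ofaceSucc c) q with hp
    have hppos : 0 < p := minimalPeriod_pos_of_mem_periodicPts hq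
    refine ⟨m + (p - n % p), ?_⟩
    have hle : n % p ≤ p := (Nat.mod_lt _ hppos).le
    calc (ofaceSucc c)^[m + (p - n % p)] ((ofaceSucc c)^[n] q)
        = (ofaceSucc c)^[m + (p - n % p)] ((ofaceSucc c)^[n % p] q) := by
          rw [iterate_mod_minimalPeriod_eq]
      _ = (ofaceSucc c)^[m + p] q := by
          rw [← Function.iterate_add_apply]
          congr 1
          omega
      _ = (ofaceSucc c)^[m] q := by
          rw [Function.iterate_add_apply, hp, iterate_minimalPeriod]

/-- **A face is the face of each of its darts.** -/
theorem ofaceOf_eq_of_mem {q q' : Fin 14 × Fin 14} (hq : q ∈ periodicPts (ofaceSucc c))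
    (hq' : q' ∈ ofaceOf c q) : ofaceOf c q' = ofaceOf c q := by
  obtain ⟨n, rfl⟩ := (mem_ofaceOf_iff hq).1 hq'
  exact ofaceOf_iterate hq n

/-- Darts on a common face have the same face length. -/
theorem ofaceLen_eq_of_mem {q q' : Fin 14 × Fin 14} (hq : q ∈ periodicPts (ofaceSucc c))
    (hq' : q' ∈ ofaceOf c q) : ofaceLen c q' = ofaceLen c q := by
  rw [← card_ofaceOf, ← card_ofaceOf, ofaceOf_eq_of_mem hq hq']

/-- A face consists of darts (admissible, `D² < 3`). -/
theorem IsGapConfig.ofaceOf_subset_darts (hc : IsGapConfig c) (hD3 : intruderDist c ^ 2 < 3)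
    {q : Fin 14 × Fin 14} (hq : q ∈ darts c) : ofaceOf c q ⊆ darts c := by
  intro q' hq'
  obtain ⟨n, rfl⟩ := (mem_ofaceOf_iff (hc.mem_periodicPts_ofaceSucc hD3 hq)).1 hq'
  exact hc.iterate_ofaceSucc_mem_darts hD3 hq n

/-! ## The set of ofaces; the ofaces partition the darts -/

/-- **The ofaces of the tight map**: the distinct `φ`-orbits of the darts. -/
def ofaces (c : Fin 14 → EuclideanSpace ℝ (Fin 3)) : Finset (Finset (Fin 14 × Fin 14)) :=
  (darts c).image (ofaceOf c)

/-- **The number of ofaces** of the tight map. -/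
def onumFaces (c : Fin 14 → EuclideanSpace ℝ (Fin 3)) : ℕ :=
  (ofaces c).card

/-- Membership in `ofaces`. -/
theorem mem_ofaces_iff {F : Finset (Fin 14 × Fin 14)} :
    F ∈ ofaces c ↔ ∃ q ∈ darts c, ofaceOf c q = F := by
  unfold ofaces
  rw [Finset.mem_image]

/-- The face of a dart is a face. -/
theorem ofaceOf_mem_ofaces {q : Fin 14 × Fin 14} (hq : q ∈ darts c) : ofaceOf c q ∈ ofaces c :=
  mem_ofaces_iff.2 ⟨q, hq, rfl⟩

/-- Every face is nonempty (admissible, `D² < 3`). -/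
theorem IsGapConfig.nonempty_of_mem_ofaces (hc : IsGapConfig c) (hD3 : intruderDist c ^ 2 < 3)
    {F : Finset (Fin 14 × Fin 14)} (hF : F ∈ ofaces c) : F.Nonempty := by
  obtain ⟨q, hq, rfl⟩ := mem_ofaces_iff.1 hF
  exact ⟨q, self_mem_ofaceOf (hc.mem_periodicPts_ofaceSucc hD3 hq)⟩

/-- Every face consists of darts (admissible, `D² < 3`). -/
theorem IsGapConfig.subset_darts_of_mem_ofaces (hc : IsGapConfig c) (hD3 : intruderDist c ^ 2 < 3)
    {F : Finset (Fin 14 × Fin 14)} (hF : F ∈ ofaces c) : F ⊆ darts c := by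
  obtain ⟨q, hq, rfl⟩ := mem_ofaces_iff.1 hF
  exact hc.ofaceOf_subset_darts hD3 hq

/-- A face is the face of each of its darts (admissible, `D² < 3`). -/
theorem IsGapConfig.ofaceOf_eq_of_mem_ofaces (hc : IsGapConfig c) (hD3 : intruderDist c ^ 2 < 3)
    {F : Finset (Fin 14 × Fin 14)} (hF : F ∈ ofaces c) {q : Fin 14 × Fin 14} (hq : q ∈ F) :
    ofaceOf c q = F := by
  obtain ⟨q₀, hq₀, rfl⟩ := mem_ofaces_iff.1 hF
  exact ofaceOf_eq_of_mem (hc.mem_periodicPts_ofaceSucc hD3 hq₀) hq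

/-- **Distinct ofaces are disjoint** (admissible, `D² < 3`). -/
theorem IsGapConfig.pairwiseDisjoint_ofaces (hc : IsGapConfig c) (hD3 : intruderDist c ^ 2 < 3) :
    (ofaces c : Set (Finset (Fin 14 × Fin 14))).PairwiseDisjoint id := by
  intro F hF F' hF' hne
  rw [Finset.mem_coe] at hF hF'
  rw [Function.onFun, id, id, Finset.disjoint_left]
  intro q hq hq'
  exact hne ((hc.ofaceOf_eq_of_mem_ofaces hD3 hF hq).symm.trans (hc.ofaceOf_eq_of_mem_ofaces hD3 hF' hq'))

/-- **The ofaces cover the darts** (admissible, `D² < 3`). -/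
theorem IsGapConfig.biUnion_ofaces (hc : IsGapConfig c) (hD3 : intruderDist c ^ 2 < 3) :
    (ofaces c).biUnion id = darts c := by
  ext q
  rw [Finset.mem_biUnion]
  constructor
  · rintro ⟨F, hF, hq⟩
    exact hc.subset_darts_of_mem_ofaces hD3 hF hq
  · intro hq
    exact ⟨ofaceOf c q, ofaceOf_mem_ofaces hq, self_mem_ofaceOf (hc.mem_periodicPts_ofaceSucc hD3 hq)⟩

/-- Summing over the darts face by face (admissible, `D² < 3`). -/
theorem IsGapConfig.sum_ofaces_sum (hc : IsGapConfig c) (hD3 : intruderDist c ^ 2 < 3)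
    (f : Fin 14 × Fin 14 → ℝ) : ∑ F ∈ ofaces c, ∑ q ∈ F, f q = ∑ q ∈ darts c, f q := by
  rw [← hc.biUnion_ofaces hD3, Finset.sum_biUnion (hc.pairwiseDisjoint_ofaces hD3)]
  rfl

/-- **The ofaces partition the darts: `Σ_{F ∈ ofaces c} #F = #darts c = 2 · tightCount c`**
(admissible, `D² < 3`). -/
theorem IsGapConfig.sum_card_ofaces (hc : IsGapConfig c) (hD3 : intruderDist c ^ 2 < 3) :
    ∑ F ∈ ofaces c, F.card = 2 * tightCount c := by
  rw [← card_darts c, ← hc.biUnion_ofaces hD3, Finset.card_biUnion (hc.pairwiseDisjoint_ofaces hD3)]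
  rfl

/-! ## Every face has at least three darts (under the census socket) -/

/-- The face successor moves every dart (the head becomes the tail). -/
theorem ofaceSucc_ne_self {q : Fin 14 × Fin 14} (hq : q ∈ darts c) : ofaceSucc c q ≠ q := by
  intro h
  have h1 : (ofaceSucc c q).1 = q.1 := by rw [h]
  simp only [ofaceSucc] at h1
  exact (mem_darts.1 hq).2.2.1 h1.symm

/-- Under the socket hypothesis no face walk closes after two steps: `φ (φ q) ≠ q` (a
`2`-cycle through `q = (i, j)` would force `nextNbr c j i = i`, i.e. tight degree `1` at `j`). -/
theorem CensusRows.ofaceSucc_ofaceSucc_ne_self (h : CensusRows c) {q : Fin 14 × Fin 14}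
    (hq : q ∈ darts c) : ofaceSucc c (ofaceSucc c q) ≠ q := by
  intro h2
  have h1 : (ofaceSucc c (ofaceSucc c q)).1 = q.1 := by rw [h2]
  simp only [ofaceSucc] at h1
  -- `h1 : onextNbr c q.2 q.1 = q.1`
  have hj0 : q.2 ≠ 0 := (mem_darts.1 hq).2.1
  have hi : q.1 ∈ tightNbrs c q.2 := by
    have := snd_mem_tightNbrs_of_mem_darts (swap_mem_darts hq)
    simpa only [Prod.fst_swap, Prod.snd_swap] using this
  exact (h.onextNbr_mem_ne hj0 hi).2 h1

/-- **Every face has at least three darts** under the socket hypothesis. -/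
theorem CensusRows.three_le_ofaceLen (h : CensusRows c) {q : Fin 14 × Fin 14} (hq : q ∈ darts c) :
    3 ≤ ofaceLen c q := by
  obtain ⟨hD3, -, -⟩ := h.intruderDist_bounds
  have hpos := h.isGapConfig.ofaceLen_pos hD3 hq
  have hfix := iterate_ofaceLen c q
  have h1 : ofaceLen c q ≠ 1 := fun h1 => by
    rw [h1] at hfix
    exact ofaceSucc_ne_self hq hfix
  have h2 : ofaceLen c q ≠ 2 := fun h2 => by
    rw [h2] at hfix
    exact h.ofaceSucc_ofaceSucc_ne_self hq hfix
  omega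

/-- Under the socket hypothesis every face has at least three darts. -/
theorem CensusRows.three_le_card_of_mem_ofaces (h : CensusRows c) {F : Finset (Fin 14 × Fin 14)}
    (hF : F ∈ ofaces c) : 3 ≤ F.card := by
  obtain ⟨q, hq, rfl⟩ := mem_ofaces_iff.1 hF
  rw [card_ofaceOf]
  exact h.three_le_ofaceLen hq

/-- Hence under the socket hypothesis `3 · onumFaces c ≤ 2 · tightCount c`. -/
theorem CensusRows.three_mul_onumFaces_le (h : CensusRows c) :
    3 * onumFaces c ≤ 2 * tightCount c := by
  obtain ⟨hD3, -, -⟩ := h.intruderDist_bounds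
  rw [← h.isGapConfig.sum_card_ofaces hD3, onumFaces, Finset.card_eq_sum_ones, Finset.mul_sum]
  exact Finset.sum_le_sum fun F hF => by simpa using h.three_le_card_of_mem_ofaces hF

/-! ## Corner sums of ofaces; Euler's formula as an angle identity -/

/-- **The sum of the corners of a face** (its corner at the head of each of its darts). -/
def ofaceAngleSum (c : Fin 14 → EuclideanSpace ℝ (Fin 3)) (F : Finset (Fin 14 × Fin 14)) : ℝ :=
  ∑ q ∈ F, ofaceCorner c q

/-- **Summing the corner sums over the ofaces gives `2π · #activeVertices c`** (admissible,
`D² < 3`): the ofaces partition the darts and the darts at each active vertex carry its gaps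
(`IsGapConfig.sum_ofaceCorner`). -/
theorem IsGapConfig.sum_ofaceAngleSum (hc : IsGapConfig c) (hD3 : intruderDist c ^ 2 < 3) :
    ∑ F ∈ ofaces c, ofaceAngleSum c F = 2 * Real.pi * (activeVertices c).card := by
  unfold ofaceAngleSum
  rw [hc.sum_ofaces_sum hD3, hc.sum_ofaceCorner hD3]

/-- **Euler's formula for the tight map as an angle identity.** For an admissible configuration
with `intruderDist² < 3`:
`Σ_{F ∈ ofaces c} (ofaceAngleSum c F − (#F − 2)·π) = 2π · (#activeVertices c − tightCount c + onumFaces c)`.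
The left side is the total ANGULAR EXCESS of the ofaces (for a face bounding a disc with those
corners, its area by Gauss–Bonnet); so `V′ − E + F = 2` for the tight map (`V′` = active vertices,
`E` = tight pairs, `F` = ofaces) is equivalent to "total excess `= 4π`" (the area of the sphere). -/
theorem IsGapConfig.oriented_euler_angle_identity (hc : IsGapConfig c) (hD3 : intruderDist c ^ 2 < 3) :
    ∑ F ∈ ofaces c, (ofaceAngleSum c F - ((F.card : ℝ) - 2) * Real.pi) =
      2 * Real.pi * ((activeVertices c).card - (tightCount c : ℝ) + onumFaces c) := by
  have hcard : ∑ F ∈ ofaces c, (F.card : ℝ) = 2 * tightCount c := by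
    rw [← Nat.cast_sum, hc.sum_card_ofaces hD3]
    push_cast
    ring
  have h1 : ∑ F ∈ ofaces c, (ofaceAngleSum c F - ((F.card : ℝ) - 2) * Real.pi) =
      ∑ F ∈ ofaces c, ofaceAngleSum c F - (∑ F ∈ ofaces c, ((F.card : ℝ) - 2)) * Real.pi := by
    rw [Finset.sum_sub_distrib, Finset.sum_mul]
  rw [h1, hc.sum_ofaceAngleSum hD3, Finset.sum_sub_distrib, hcard, Finset.sum_const, nsmul_eq_mul,
    onumFaces]
  ring

/-- **Euler ⟺ total excess `4π`** (admissible, `D² < 3`): the tight map satisfies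
`#activeVertices − tightCount + onumFaces = 2` iff the total angular excess of its ofaces is `4π`. -/
theorem IsGapConfig.oriented_euler_iff_excess (hc : IsGapConfig c) (hD3 : intruderDist c ^ 2 < 3) :
    ((activeVertices c).card : ℝ) - tightCount c + onumFaces c = 2 ↔
      ∑ F ∈ ofaces c, (ofaceAngleSum c F - ((F.card : ℝ) - 2) * Real.pi) = 4 * Real.pi := by
  rw [hc.oriented_euler_angle_identity hD3]
  constructor
  · intro h
    rw [h]
    ring
  · intro h
    have hpi : Real.pi ≠ 0 := Real.pi_pos.ne'
    have : 2 * Real.pi * ((activeVertices c).card - (tightCount c : ℝ) + onumFaces c - 2) = 0 := by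
      linarith
    rcases mul_eq_zero.1 this with h0 | h0
    · exact absurd h0 (mul_ne_zero two_ne_zero hpi)
    · linarith

end Summit.Ventures.Crystal3D
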